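import Summits.CriticalPhenomena.PercolationContinuityZ3.Theorems.PercNearOneGluingNoHeavyLowerTailThreePartitionGridHall
import HarnessLib.Audit

/-!
# `NoHeavyLowerTail` (crux stmt-CriticalPhenomena-4575), master-family hierarchy P3 (gen 36): MONOTONICITY of the grid-transport
# kernel sum in `𝒱 ∖ 𝒲` and in `𝒲 ∖ 𝒱` (V-RED / W-RED), and the reduction of `GridTransport` to TERMINAL pairs
# `(𝒱, 𝒲) = (𝒜 ⊔ D(𝒜,𝒲), 𝒲)` with `𝒜 ⊆ 𝒲` nested

Support file (seat `prim-masterthm-p3`; `--supports stmt-CriticalPhenomena-4575`; memos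
`run/shared/lean/prim/prim-masterthm/FROM-prim-masterthm-p3-g34-FIBRE-LOCAL-CERTIFICATE.md` §1(a),(e) and
`…/FROM-prim-masterthm-p3-g36-*.md`).  Companion of `…ThreePartitionGridTransport` (`gtKernel`, `GridTransport`),
`…ThreePartitionGridNested` (`sum_gtKernel_filter_eq`, the fibrewise Kleitman moves `triT_move23_le` / `triT_move32_le`) and
`…ThreePartitionGridHall` (`gtMatchable_iff`).

THE TWO MONOTONICITIES (this file, proved; memo g34 §1(a)).  For a family `𝒰` of configurations closed upwards in the grid order,
write `S(𝒰;𝒱,𝒲) = ∑_{q∈𝒰} κ_{τ,𝒱,𝒲}(q)`; `S` is bilinear in `(1_𝒱, 1_𝒲)` and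
* **V-RED** (`sum_gtKernel_anti_left`): enlarging `𝒱` by sets OUTSIDE `𝒲` can only DECREASE `S` — for `𝒱 ⊆ 𝒱'` with
  `𝒱' ∩ 𝒲 ⊆ 𝒱`: `S(𝒰;𝒱',𝒲) ≤ S(𝒰;𝒱,𝒲)`.  (The increment is `T(x₂∈E,x₃∈𝒲) − T(x₁∈𝒲,x₂∈E) − T(x₁∈E,x₃∈𝒲) ≤ 0`, `E = 𝒱'∖𝒱`,
  by ONE x₂-fibre Kleitman move.)
* **W-RED** (`sum_gtKernel_anti_right`): enlarging `𝒲` by sets outside `𝒱` can only decrease `S` — for `𝒲 ⊆ 𝒲'` with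
  `𝒲' ∩ 𝒱 ⊆ 𝒲`: `S(𝒰;𝒱,𝒲') ≤ S(𝒰;𝒱,𝒲)` (one x₃-fibre Kleitman move).
THE TERMINAL REDUCTION (this file, proved; memo g34 §1(e)).  For nested up-sets `𝒜 ⊆ 𝒲` let
`D(𝒜,𝒲) = {v ∉ 𝒲 : every w ⊇ v with w ∈ 𝒲 lies in 𝒜}` (`dCl`) and `V⋆(𝒜,𝒲) = 𝒜 ∪ D(𝒜,𝒲)` (`vStar`): the LARGEST up-set `𝒱`
with `𝒱 ∩ 𝒲 = 𝒜` (`isUpperSet_vStar`, `mem_vStar_inter`, `subset_vStar`).  By V-RED every instance `(𝒱,𝒲)` is dominated by its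
terminal representative: `S(𝒰; V⋆(𝒱∩𝒲,𝒲), 𝒲) ≤ S(𝒰;𝒱,𝒲)` (`sum_gtKernel_vStar_le`).  Hence
**`GridTransport ⟺` the kernel sum is `≥ 0` on every up-closed `𝒰` for every TERMINAL pair `(V⋆(𝒜,𝒲), 𝒲)`, `𝒜 ⊆ 𝒲` nested
up-sets** (`gridTransport_iff_terminal`), **`⟺` every terminal pair has a token matching** (`gridTransport_iff_gtMatchable_terminal`),
and in particular a TYPED matching for every terminal pair proves `GridTransport` (`gridTransport_of_typedMatchable_terminal`) —
the form in which the classes `…GridTop` (`𝒜 = 𝒲`, i.e. `V⋆ = ⊤`), `…GridBalanced`, `…GridSubset` (`D = ∅`) are stated and in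
which the seat's token normal form (bad tokens `{x₁ ∈ D, x₃ ∈ 𝒲}`, …) lives.
HONEST LABEL: two elementary monotonicities and a bookkeeping reduction of an OPEN conjecture; `GridTransport`, COMB-C3 and Sahi's
`C₃` remain OPEN; nothing here bears on the (closed) crux. [this work]
-/

noncomputable section

open Finset
open scoped symmDiff Classical

namespace Summit.CriticalPhenomena.PercolationContinuityZ3.Theorems.ThreePartition

variable {ι : Type*} [Fintype ι]

/-! ## V-RED and W-RED -/

/-- **V-RED.**  Enlarging `𝒱` by sets outside `𝒲` can only decrease the kernel sum over an up-closed family: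
for `𝒱 ⊆ 𝒱'` with `𝒱' ∩ 𝒲 ⊆ 𝒱` and `𝒲` an up-set, `∑_{q∈𝒰} κ_{τ,𝒱',𝒲}(q) ≤ ∑_{q∈𝒰} κ_{τ,𝒱,𝒲}(q)`.
The increment is `T(x₂∈E, x₃∈𝒲) − T(x₁∈𝒲, x₂∈E) − T(x₁∈E, x₃∈𝒲)` with `E = 𝒱' ∖ 𝒱`, and the first two terms compare by the
x₂-fibre Kleitman move `triT_move32_le`. [this work] -/
theorem sum_gtKernel_anti_left (τ : Set ι) {𝒱 𝒱' 𝒲 : Set (Set ι)} {𝒰 : Set (Set ι × Set ι)}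
    (h𝒲 : IsUpperSet 𝒲) (hVV' : 𝒱 ⊆ 𝒱') (hE : ∀ v ∈ 𝒱', v ∈ 𝒲 → v ∈ 𝒱)
    (h𝒰 : ∀ q q' : Set ι × Set ι, q ∈ 𝒰 → q.1 ∆ τ ⊆ q'.1 ∆ τ → q'.2 ∆ τ ⊆ q.2 ∆ τ → q' ∈ 𝒰) :
    ∑ q ∈ (cfgs ι).filter (fun q => q ∈ 𝒰), gtKernel τ 𝒱' 𝒲 q
      ≤ ∑ q ∈ (cfgs ι).filter (fun q => q ∈ 𝒰), gtKernel τ 𝒱 𝒲 q := by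
  rw [sum_gtKernel_filter_eq, sum_gtKernel_filter_eq]
  set U := inU τ 𝒰 with hU
  -- the `𝒱 ∩ 𝒲` counts do not change
  have e1 : triT τ (fun a b _ => U a b ∧ a ∈ 𝒱' ∩ 𝒲) = triT τ (fun a b _ => U a b ∧ a ∈ 𝒱 ∩ 𝒲) :=
    triT_congr fun a b c => by
      simp only [Set.mem_inter_iff]
      exact ⟨fun h => ⟨h.1, hE a h.2.1 h.2.2, h.2.2⟩, fun h => ⟨h.1, hVV' h.2.1, h.2.2⟩⟩
  have e5 : triT τ (fun a b _ => U a b ∧ b ∈ 𝒱' ∩ 𝒲) = triT τ (fun a b _ => U a b ∧ b ∈ 𝒱 ∩ 𝒲) :=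
    triT_congr fun a b c => by
      simp only [Set.mem_inter_iff]
      exact ⟨fun h => ⟨h.1, hE b h.2.1 h.2.2, h.2.2⟩, fun h => ⟨h.1, hVV' h.2.1, h.2.2⟩⟩
  -- the three other counts split by `∈ 𝒱`
  have s2 := triT_and_add_triT_and_not τ (fun a b c => U a b ∧ (b ∈ 𝒱' ∧ c ∈ 𝒲)) (fun _ b _ => b ∈ 𝒱)
  have s3 := triT_and_add_triT_and_not τ (fun a b c => U a b ∧ (a ∈ 𝒱' ∧ c ∈ 𝒲)) (fun a _ _ => a ∈ 𝒱)
  have s4 := triT_and_add_triT_and_not τ (fun a b _ => U a b ∧ (a ∈ 𝒲 ∧ b ∈ 𝒱')) (fun _ b _ => b ∈ 𝒱)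
  have t2 : triT τ (fun a b c => (U a b ∧ (b ∈ 𝒱' ∧ c ∈ 𝒲)) ∧ b ∈ 𝒱) = triT τ (fun a b c => U a b ∧ (b ∈ 𝒱 ∧ c ∈ 𝒲)) :=
    triT_congr fun a b c => ⟨fun h => ⟨h.1.1, h.2, h.1.2.2⟩, fun h => ⟨⟨h.1, hVV' h.2.1, h.2.2⟩, h.2.1⟩⟩
  have t3 : triT τ (fun a b c => (U a b ∧ (a ∈ 𝒱' ∧ c ∈ 𝒲)) ∧ a ∈ 𝒱) = triT τ (fun a b c => U a b ∧ (a ∈ 𝒱 ∧ c ∈ 𝒲)) :=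
    triT_congr fun a b c => ⟨fun h => ⟨h.1.1, h.2, h.1.2.2⟩, fun h => ⟨⟨h.1, hVV' h.2.1, h.2.2⟩, h.2.1⟩⟩
  have t4 : triT τ (fun a b _ => (U a b ∧ (a ∈ 𝒲 ∧ b ∈ 𝒱')) ∧ b ∈ 𝒱) = triT τ (fun a b _ => U a b ∧ (a ∈ 𝒲 ∧ b ∈ 𝒱)) :=
    triT_congr fun a b c => ⟨fun h => ⟨h.1.1, h.1.2.1, h.2⟩, fun h => ⟨⟨h.1, h.2.1, hVV' h.2.2⟩, h.2.2⟩⟩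
  -- the x₂-fibre Kleitman move on the layer `x₂ ∈ E = 𝒱' ∖ 𝒱`
  have hR : ∀ b : Set ι, IsUpperSet {a : Set ι | b ∈ 𝒱' ∧ b ∉ 𝒱} := fun b a a' _ ha => ha
  have k := triT_move32_le τ h𝒰 (fun _ b => b ∈ 𝒱' ∧ b ∉ 𝒱) hR h𝒲
  have k2 : triT τ (fun a b c => (U a b ∧ (b ∈ 𝒱' ∧ c ∈ 𝒲)) ∧ ¬ b ∈ 𝒱)
      = triT τ (fun a b c => (inU τ 𝒰 a b ∧ (b ∈ 𝒱' ∧ b ∉ 𝒱)) ∧ c ∈ 𝒲) := triT_congr fun a b c => by simp only [hU]; tauto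
  have k4 : triT τ (fun a b _ => (U a b ∧ (a ∈ 𝒲 ∧ b ∈ 𝒱')) ∧ ¬ b ∈ 𝒱)
      = triT τ (fun a b _ => (inU τ 𝒰 a b ∧ (b ∈ 𝒱' ∧ b ∉ 𝒱)) ∧ a ∈ 𝒲) := triT_congr fun a b c => by simp only [hU]; tauto
  have nn : 0 ≤ triT τ (fun a b c => (U a b ∧ (a ∈ 𝒱' ∧ c ∈ 𝒲)) ∧ ¬ a ∈ 𝒱) := Nat.zero_le _
  rw [e1, e5]
  rw [t2, k2] at s2
  rw [t3] at s3
  rw [t4, k4] at s4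
  zify at s2 s3 s4 k nn
  linarith

/-- **W-RED.**  Enlarging `𝒲` by sets outside `𝒱` can only decrease the kernel sum over an up-closed family:
for `𝒲 ⊆ 𝒲'` with `𝒲' ∩ 𝒱 ⊆ 𝒲` and `𝒱` an up-set, `∑_{q∈𝒰} κ_{τ,𝒱,𝒲'}(q) ≤ ∑_{q∈𝒰} κ_{τ,𝒱,𝒲}(q)`.
The increment is `T(x₂∈𝒱, x₃∈F) − T(x₁∈𝒱, x₃∈F) − T(x₁∈F, x₂∈𝒱)` with `F = 𝒲' ∖ 𝒲`; x₃-fibre Kleitman `triT_move23_le`.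
[this work] -/
theorem sum_gtKernel_anti_right (τ : Set ι) {𝒱 𝒲 𝒲' : Set (Set ι)} {𝒰 : Set (Set ι × Set ι)}
    (h𝒱 : IsUpperSet 𝒱) (hWW' : 𝒲 ⊆ 𝒲') (hF : ∀ w ∈ 𝒲', w ∈ 𝒱 → w ∈ 𝒲)
    (h𝒰 : ∀ q q' : Set ι × Set ι, q ∈ 𝒰 → q.1 ∆ τ ⊆ q'.1 ∆ τ → q'.2 ∆ τ ⊆ q.2 ∆ τ → q' ∈ 𝒰) :
    ∑ q ∈ (cfgs ι).filter (fun q => q ∈ 𝒰), gtKernel τ 𝒱 𝒲' q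
      ≤ ∑ q ∈ (cfgs ι).filter (fun q => q ∈ 𝒰), gtKernel τ 𝒱 𝒲 q := by
  rw [sum_gtKernel_filter_eq, sum_gtKernel_filter_eq]
  set U := inU τ 𝒰 with hU
  have e1 : triT τ (fun a b _ => U a b ∧ a ∈ 𝒱 ∩ 𝒲') = triT τ (fun a b _ => U a b ∧ a ∈ 𝒱 ∩ 𝒲) :=
    triT_congr fun a b c => by
      simp only [Set.mem_inter_iff]
      exact ⟨fun h => ⟨h.1, h.2.1, hF a h.2.2 h.2.1⟩, fun h => ⟨h.1, h.2.1, hWW' h.2.2⟩⟩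
  have e5 : triT τ (fun a b _ => U a b ∧ b ∈ 𝒱 ∩ 𝒲') = triT τ (fun a b _ => U a b ∧ b ∈ 𝒱 ∩ 𝒲) :=
    triT_congr fun a b c => by
      simp only [Set.mem_inter_iff]
      exact ⟨fun h => ⟨h.1, h.2.1, hF b h.2.2 h.2.1⟩, fun h => ⟨h.1, h.2.1, hWW' h.2.2⟩⟩
  have s2 := triT_and_add_triT_and_not τ (fun a b c => U a b ∧ (b ∈ 𝒱 ∧ c ∈ 𝒲')) (fun _ _ c => c ∈ 𝒲)
  have s3 := triT_and_add_triT_and_not τ (fun a b c => U a b ∧ (a ∈ 𝒱 ∧ c ∈ 𝒲')) (fun _ _ c => c ∈ 𝒲)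
  have s4 := triT_and_add_triT_and_not τ (fun a b _ => U a b ∧ (a ∈ 𝒲' ∧ b ∈ 𝒱)) (fun a _ _ => a ∈ 𝒲)
  have t2 : triT τ (fun a b c => (U a b ∧ (b ∈ 𝒱 ∧ c ∈ 𝒲')) ∧ c ∈ 𝒲) = triT τ (fun a b c => U a b ∧ (b ∈ 𝒱 ∧ c ∈ 𝒲)) :=
    triT_congr fun a b c => ⟨fun h => ⟨h.1.1, h.1.2.1, h.2⟩, fun h => ⟨⟨h.1, h.2.1, hWW' h.2.2⟩, h.2.2⟩⟩
  have t3 : triT τ (fun a b c => (U a b ∧ (a ∈ 𝒱 ∧ c ∈ 𝒲')) ∧ c ∈ 𝒲) = triT τ (fun a b c => U a b ∧ (a ∈ 𝒱 ∧ c ∈ 𝒲)) :=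
    triT_congr fun a b c => ⟨fun h => ⟨h.1.1, h.1.2.1, h.2⟩, fun h => ⟨⟨h.1, h.2.1, hWW' h.2.2⟩, h.2.2⟩⟩
  have t4 : triT τ (fun a b _ => (U a b ∧ (a ∈ 𝒲' ∧ b ∈ 𝒱)) ∧ a ∈ 𝒲) = triT τ (fun a b _ => U a b ∧ (a ∈ 𝒲 ∧ b ∈ 𝒱)) :=
    triT_congr fun a b c => ⟨fun h => ⟨h.1.1, h.2, h.1.2.2⟩, fun h => ⟨⟨h.1, hWW' h.2.1, h.2.2⟩, h.2.1⟩⟩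
  -- the x₃-fibre Kleitman move on the fibres `x₃ ∈ F = 𝒲' ∖ 𝒲`
  have hR : ∀ c : Set ι, IsUpperSet {a : Set ι | c ∈ 𝒲' ∧ c ∉ 𝒲} := fun c a a' _ ha => ha
  have k := triT_move23_le τ h𝒰 (fun _ c => c ∈ 𝒲' ∧ c ∉ 𝒲) hR h𝒱
  have k2 : triT τ (fun a b c => (U a b ∧ (b ∈ 𝒱 ∧ c ∈ 𝒲')) ∧ ¬ c ∈ 𝒲)
      = triT τ (fun a b c => (inU τ 𝒰 a b ∧ (c ∈ 𝒲' ∧ c ∉ 𝒲)) ∧ b ∈ 𝒱) := triT_congr fun a b c => by simp only [hU]; tauto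
  have k3 : triT τ (fun a b c => (U a b ∧ (a ∈ 𝒱 ∧ c ∈ 𝒲')) ∧ ¬ c ∈ 𝒲)
      = triT τ (fun a b c => (inU τ 𝒰 a b ∧ (c ∈ 𝒲' ∧ c ∉ 𝒲)) ∧ a ∈ 𝒱) := triT_congr fun a b c => by simp only [hU]; tauto
  have nn : 0 ≤ triT τ (fun a b _ => (U a b ∧ (a ∈ 𝒲' ∧ b ∈ 𝒱)) ∧ ¬ a ∈ 𝒲) := Nat.zero_le _
  rw [e1, e5]
  rw [t2, k2] at s2
  rw [t3, k3] at s3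
  rw [t4] at s4
  zify at s2 s3 s4 k nn
  linarith

/-! ## Terminal pairs -/

omit [Fintype ι] in
/-- `D(𝒜,𝒲) = {v ∉ 𝒲 : every w ⊇ v with w ∈ 𝒲 lies in 𝒜}` — the sets outside `𝒲` that may be ADDED to `𝒜` without changing the
trace on `𝒲` and keeping an up-set (memo g34 §1(e); the `x₁`-values of the seat's 'bad' tokens). [this work] -/
def dCl (𝒜 𝒲 : Set (Set ι)) : Set (Set ι) := {v | v ∉ 𝒲 ∧ ∀ w : Set ι, v ⊆ w → w ∈ 𝒲 → w ∈ 𝒜}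

omit [Fintype ι] in
/-- The TERMINAL representative `V⋆(𝒜,𝒲) = 𝒜 ∪ D(𝒜,𝒲)` of all up-sets `𝒱` with `𝒱 ∩ 𝒲 = 𝒜`. [this work] -/
def vStar (𝒜 𝒲 : Set (Set ι)) : Set (Set ι) := 𝒜 ∪ dCl 𝒜 𝒲

omit [Fintype ι] in
/-- `V⋆(𝒜,𝒲)` is an up-set whenever `𝒜` is. [this work] -/
theorem isUpperSet_vStar {𝒜 𝒲 : Set (Set ι)} (h𝒜 : IsUpperSet 𝒜) : IsUpperSet (vStar 𝒜 𝒲) := by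
  intro v v' hle hv
  rcases hv with hv | ⟨_, hv⟩
  · exact Or.inl (h𝒜 hle hv)
  · by_cases hv'W : v' ∈ 𝒲
    · exact Or.inl (hv v' hle hv'W)
    · exact Or.inr ⟨hv'W, fun w hw hwW => hv w (hle.trans hw) hwW⟩

omit [Fintype ι] in
/-- The trace of `V⋆(𝒜,𝒲)` on `𝒲` is `𝒜` (for `𝒜 ⊆ 𝒲`): `v ∈ V⋆ ∧ v ∈ 𝒲 ↔ v ∈ 𝒜`. [this work] -/
theorem mem_vStar_inter {𝒜 𝒲 : Set (Set ι)} (h : 𝒜 ⊆ 𝒲) (v : Set ι) : v ∈ vStar 𝒜 𝒲 ∧ v ∈ 𝒲 ↔ v ∈ 𝒜 := by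
  constructor
  · rintro ⟨hv | ⟨hvW, _⟩, hvW'⟩
    · exact hv
    · exact absurd hvW' hvW
  · exact fun hv => ⟨Or.inl hv, h hv⟩

omit [Fintype ι] in
/-- `V⋆` is the LARGEST up-set with the given trace: every up-set `𝒱` lies in `V⋆(𝒱 ∩ 𝒲, 𝒲)`. [this work] -/
theorem subset_vStar {𝒱 : Set (Set ι)} (h𝒱 : IsUpperSet 𝒱) (𝒲 : Set (Set ι)) : 𝒱 ⊆ vStar (𝒱 ∩ 𝒲) 𝒲 := by
  intro v hv
  by_cases hvW : v ∈ 𝒲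
  · exact Or.inl ⟨hv, hvW⟩
  · exact Or.inr ⟨hvW, fun w hw hwW => ⟨h𝒱 hw hv, hwW⟩⟩

/-- **Every instance is dominated by its terminal representative**: `∑_{q∈𝒰} κ_{τ,V⋆(𝒱∩𝒲,𝒲),𝒲}(q) ≤ ∑_{q∈𝒰} κ_{τ,𝒱,𝒲}(q)`
for up-sets `𝒱, 𝒲` and every up-closed `𝒰` (V-RED applied to `𝒱 ⊆ V⋆(𝒱∩𝒲,𝒲)`). [this work] -/
theorem sum_gtKernel_vStar_le (τ : Set ι) {𝒱 𝒲 : Set (Set ι)} {𝒰 : Set (Set ι × Set ι)}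
    (h𝒱 : IsUpperSet 𝒱) (h𝒲 : IsUpperSet 𝒲)
    (h𝒰 : ∀ q q' : Set ι × Set ι, q ∈ 𝒰 → q.1 ∆ τ ⊆ q'.1 ∆ τ → q'.2 ∆ τ ⊆ q.2 ∆ τ → q' ∈ 𝒰) :
    ∑ q ∈ (cfgs ι).filter (fun q => q ∈ 𝒰), gtKernel τ (vStar (𝒱 ∩ 𝒲) 𝒲) 𝒲 q
      ≤ ∑ q ∈ (cfgs ι).filter (fun q => q ∈ 𝒰), gtKernel τ 𝒱 𝒲 q :=
  sum_gtKernel_anti_left τ h𝒲 (subset_vStar h𝒱 𝒲)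
    (fun v hv hvW => ((mem_vStar_inter (Set.inter_subset_right : 𝒱 ∩ 𝒲 ⊆ 𝒲) v).1 ⟨hv, hvW⟩).1) h𝒰

/-- The mirror statement on the `𝒲`-side: `∑_{q∈𝒰} κ_{τ,𝒱,V⋆(𝒲∩𝒱,𝒱)}(q) ≤ ∑_{q∈𝒰} κ_{τ,𝒱,𝒲}(q)` — enlarging `𝒲` to the largest
up-set with the same trace on `𝒱` (W-RED applied to `𝒲 ⊆ V⋆(𝒲∩𝒱,𝒱)`); so one may assume BOTH families terminal. [this work] -/
theorem sum_gtKernel_wStar_le (τ : Set ι) {𝒱 𝒲 : Set (Set ι)} {𝒰 : Set (Set ι × Set ι)}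
    (h𝒱 : IsUpperSet 𝒱) (h𝒲 : IsUpperSet 𝒲)
    (h𝒰 : ∀ q q' : Set ι × Set ι, q ∈ 𝒰 → q.1 ∆ τ ⊆ q'.1 ∆ τ → q'.2 ∆ τ ⊆ q.2 ∆ τ → q' ∈ 𝒰) :
    ∑ q ∈ (cfgs ι).filter (fun q => q ∈ 𝒰), gtKernel τ 𝒱 (vStar (𝒲 ∩ 𝒱) 𝒱) q
      ≤ ∑ q ∈ (cfgs ι).filter (fun q => q ∈ 𝒰), gtKernel τ 𝒱 𝒲 q :=
  sum_gtKernel_anti_right τ h𝒱 (subset_vStar h𝒲 𝒱)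
    (fun w hw hwV => ((mem_vStar_inter (Set.inter_subset_right : 𝒲 ∩ 𝒱 ⊆ 𝒱) w).1 ⟨hw, hwV⟩).1) h𝒰

/-- **`GridTransport` reduces to terminal pairs**: it holds iff the kernel sum is nonnegative on every up-closed family for every
pair `(V⋆(𝒜,𝒲), 𝒲)` with `𝒜 ⊆ 𝒲` nested up-sets. [this work] -/
theorem gridTransport_iff_terminal :
    GridTransport ↔
      ∀ (ι : Type) [Fintype ι] (τ : Set ι) (𝒜 𝒲 : Set (Set ι)) (𝒰 : Set (Set ι × Set ι)),
        IsUpperSet 𝒜 → IsUpperSet 𝒲 → 𝒜 ⊆ 𝒲 →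
        (∀ q q' : Set ι × Set ι, q ∈ 𝒰 → q.1 ∆ τ ⊆ q'.1 ∆ τ → q'.2 ∆ τ ⊆ q.2 ∆ τ → q' ∈ 𝒰) →
        0 ≤ ∑ q ∈ (cfgs ι).filter (fun q => q ∈ 𝒰), gtKernel τ (vStar 𝒜 𝒲) 𝒲 q := by
  constructor
  · intro h ι _ τ 𝒜 𝒲 𝒰 h𝒜 h𝒲 _ h𝒰
    exact h ι τ (vStar 𝒜 𝒲) 𝒲 𝒰 (isUpperSet_vStar h𝒜) h𝒲 h𝒰
  · intro h ι _ τ 𝒱 𝒲 𝒰 h𝒱 h𝒲 h𝒰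
    exact le_trans (h ι τ (𝒱 ∩ 𝒲) 𝒲 𝒰 (h𝒱.inter h𝒲) h𝒲 Set.inter_subset_right h𝒰)
      (sum_gtKernel_vStar_le τ h𝒱 h𝒲 h𝒰)

/-- **`GridTransport` is the statement that every TERMINAL pair admits a token matching.** [this work] -/
theorem gridTransport_iff_gtMatchable_terminal :
    GridTransport ↔
      ∀ (ι : Type) [Fintype ι] (τ : Set ι) (𝒜 𝒲 : Set (Set ι)),
        IsUpperSet 𝒜 → IsUpperSet 𝒲 → 𝒜 ⊆ 𝒲 → GTMatchable τ (vStar 𝒜 𝒲) 𝒲 := by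
  rw [gridTransport_iff_terminal]
  constructor
  · intro h ι _ τ 𝒜 𝒲 h𝒜 h𝒲 hAW
    exact gtMatchable_of_sum_gtKernel_nonneg τ _ _ fun 𝒰 h𝒰 => h ι τ 𝒜 𝒲 𝒰 h𝒜 h𝒲 hAW h𝒰
  · intro h ι _ τ 𝒜 𝒲 𝒰 h𝒜 h𝒲 hAW h𝒰
    exact sum_gtKernel_nonneg_of_gtMatchable (h ι τ 𝒜 𝒲 h𝒜 h𝒲 hAW) h𝒰

/-- Hence **a TYPED matching for every terminal pair proves `GridTransport`** (and with it `ThreePartitionPositivityTwisted` ≡ COMB-C3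
and Sahi's `C₃` for product measures) — the form in which the kernel classes `typedMatchable_univ` (`𝒜 = 𝒲`),
`typedMatchable_of_balanced`, `typedMatchable_of_subset` (`D = ∅`) are stated. [this work] -/
theorem gridTransport_of_typedMatchable_terminal
    (h : ∀ (ι : Type) [Fintype ι] (τ : Set ι) (𝒜 𝒲 : Set (Set ι)),
      IsUpperSet 𝒜 → IsUpperSet 𝒲 → 𝒜 ⊆ 𝒲 → TypedMatchable τ (vStar 𝒜 𝒲) 𝒲) :
    GridTransport :=
  gridTransport_iff_gtMatchable_terminal.2 fun ι _ τ 𝒜 𝒲 h𝒜 h𝒲 hAW =>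
    gtMatchable_of_typedMatchable (h ι τ 𝒜 𝒲 h𝒜 h𝒲 hAW)

/-- … and then `ThreePartitionPositivityTwisted`. [this work] -/
theorem threePartitionPositivityTwisted_of_typedMatchable_terminal
    (h : ∀ (ι : Type) [Fintype ι] (τ : Set ι) (𝒜 𝒲 : Set (Set ι)),
      IsUpperSet 𝒜 → IsUpperSet 𝒲 → 𝒜 ⊆ 𝒲 → TypedMatchable τ (vStar 𝒜 𝒲) 𝒲) :
    ThreePartitionPositivityTwisted :=
  threePartitionPositivityTwisted_of_gridTransport (gridTransport_of_typedMatchable_terminal h)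

end Summit.CriticalPhenomena.PercolationContinuityZ3.Theorems.ThreePartition

end
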